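import Mathlib
import Summits.AtomisticToContinuum.Crystallization.Theorems.NashClassCertificatesNashNearFieldStubSitewisePlusCushion

/-!
# Route `NashClassCertificates`, crux `NashNearField` (stmt-AtomisticToContinuum-16827), line `birth`:
# pieces for the stub `stub_sitewisePlus` (SITEWISE⁺), II — the cushioned uniform window bound and the reduction
# `sitewisePlus_of_cbbc_cushion : CBBC → CUSHION → SITEWISE⁺`

The landed reduction CBBC ⟹ SITEWISE (p169146: splice every window behind the six letters read by the far-from-family premise,
apply the period-average bound to the spliced periodic word, compare the strained layer sums on the window, and turn the
uniform window deficit into a bounded inter-layer corrector) is re-run with the Hägg cushion carried along: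

* `swp_window_lower_bound` — from CBBC⁺ in period-sum form at level `E₀ = e⋆ + κ′r²` with cushion weight `c₁ ≥ 0`
  (`E₀·P + Σ_{k<P} [t(k−1) = t k]·c₁ ≤ Σ_{k<P} S_t(k)` for every periodic Hägg `t` that is `r`-far under `G`), every window of an
  `r`-far Hägg word `s` satisfies `(n−m+1)·E₀ + Σ_{k=m}^{n} [s(k−1) = s k]·c₁ − (99360 + 6|e⋆| + c₁) ≤ Σ_{k=m}^{n} S_s(k)`: the
  c-layers of the spliced word inside the window are those of `s` on `[m+1, n]` (one indicator lost at the seam);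
* `sitewisePlus_of_cbbc_cushion` — CBBC (registered text of `stub_cauchyBornBarlowCoercivity`, hypothesis) and CUSHION (the strained
  Hägg cushion, hypothesis; exact text and numerical audit in `SITEWISEPLUS_STATUS.md`) imply SITEWISE⁺ (registered text of
  `stub_sitewisePlus`) with `κ⁺ = 50r₀²κ`, `cH⁺ = min(cH/2, κr₀²/2)`, `Cw = 99360 + 6|e⋆| + cH⁺`, for every nearness radius
  `r₀ ∈ (0, 1/10]` of CUSHION, via `swp_cbbcPlusR` (parametric form of the landed `swp_cbbcPlus`) and the window-deficit corrector
  (`Literature.Dynamics.Ergodic.exists_corrector_of_window_sum_ge`).  Recommended `r₀ = 1/200` (audit: the k = ±1 bilinear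
  shear × in-plane-deviatoric coupling eats the cushion beyond FamFar-distance ≈ 0.009–0.013; at `1/200` the minimum over words and
  box cells stays `≥ 3.4·10⁻⁵` per c-layer).

All `[folklore]` given the two hypotheses.
-/

noncomputable section

open scoped BigOperators
open Literature.MathematicalPhysics.StatisticalMechanics Literature.Geometry.DiscreteGeometry

namespace Summit.AtomisticToContinuum.Crystallization.Theorems.NashClassCertificatesNashNearField

/-- **Stub piece `swp_cbbcPlusR`: CBBC + CUSHION(r₀) ⟹ CBBC⁺ in period-sum form, parametric nearness radius (proved).**  From the
Cauchy–Born coercivity CBBC (constant `κ`) and the strained Hägg cushion CUSHION at nearness radius `r₀ ∈ (0, 1/10]` (constant `cH`): for every periodic Hägg word `t`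
(period `P`), every automorphism `G` in the tube, every `r ∈ [0, 1/10]` with `G` `r`-far from the box family on the unit sites of
`T_t` of norm `≤ 3`,
`(e⋆ + 50r₀²κ·r²)·P + Σ_{k<P} [t(k−1) = t k]·min(cH/2, κr₀²/2) ≤ Σ_{k<P} ½Σ'_q V_LJ(dist(G b_{(k,0,0)}, G b_q))`.
Within `r₀` of the family the three inequalities CBBC(`t`, `r`), CBBC(alt, `0`), CUSHION are averaged; `r₀`-far from it CBBC(`t`, `r₀`)
alone pays `κr₀² ≥ 50r₀²κ·r² + κr₀²/2` (`r ≤ 1/10`).  (The landed `swp_cbbcPlus` is the case `r₀ = 1/100`.) [folklore] -/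
theorem swp_cbbcPlusR {κ cH r₀ : ℝ} (hκ : 0 < κ) (hcH : 0 < cH) (hr₀ : 0 < r₀) (hr₀1 : r₀ ≤ 1 / 10)
    (hCB : ∀ (s : ℤ → ℤ) (p : ℕ) (hp : p ≠ 0) (hs : ∀ i, s (i + p) = s i), IsHaggSeq s →
      ∀ (G : EuclideanSpace ℝ (Fin 3) ≃L[ℝ] EuclideanSpace ℝ (Fin 3)),
        (∀ v : EuclideanSpace ℝ (Fin 3), 4 / 5 * ‖v‖ ≤ ‖G v‖ ∧ ‖G v‖ ≤ 6 / 5 * ‖v‖) →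
        ∀ r : ℝ, 0 ≤ r → r ≤ 1 / 10 →
          (∀ (A : EuclideanSpace ℝ (Fin 3) →ₗᵢ[ℝ] EuclideanSpace ℝ (Fin 3)) (a h : ℝ), 47 / 50 ≤ a → a ≤ 1 → 39 / 50 * a ≤ h → h ≤ 17 / 20 * a →
            ∃ m u v : ℤ, ‖barlowPos 1 (Real.sqrt 6 / 3) s m u v‖ ≤ 3 ∧
              r ≤ dist (G (barlowPos 1 (Real.sqrt 6 / 3) s m u v)) (A (barlowPos a h s m u v))) →
          (⨅ Q : PeriodicConfiguration 3, Q.energyPerParticle lennardJones) + κ * r ^ 2 ≤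
            ((barlowPeriodicConfiguration s one_ne_zero sw_h0_ne hp hs).linearImage G).energyPerParticle lennardJones)
    (hCU : ∀ (s : ℤ → ℤ) (p : ℕ) (hp : p ≠ 0) (hs : ∀ i, s (i + p) = s i), IsHaggSeq s →
      ∀ (G : EuclideanSpace ℝ (Fin 3) ≃L[ℝ] EuclideanSpace ℝ (Fin 3)),
        (∀ v : EuclideanSpace ℝ (Fin 3), 4 / 5 * ‖v‖ ≤ ‖G v‖ ∧ ‖G v‖ ≤ 6 / 5 * ‖v‖) →
        (∃ (A : EuclideanSpace ℝ (Fin 3) →ₗᵢ[ℝ] EuclideanSpace ℝ (Fin 3)) (a h : ℝ), 47 / 50 ≤ a ∧ a ≤ 1 ∧ 39 / 50 * a ≤ h ∧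
            h ≤ 17 / 20 * a ∧ ∀ m u v : ℤ, ‖barlowPos 1 (Real.sqrt 6 / 3) s m u v‖ ≤ 3 →
              dist (G (barlowPos 1 (Real.sqrt 6 / 3) s m u v)) (A (barlowPos a h s m u v)) < r₀) →
        ((barlowPeriodicConfiguration alternatingHagg one_ne_zero sw_h0_ne two_ne_zero swp_alt_periodic).linearImage
              G).energyPerParticle lennardJones +
            cH * (((Finset.range p).filter (fun m : ℕ => s ((m : ℤ) - 1) = s m)).card : ℝ) / p ≤
          ((barlowPeriodicConfiguration s one_ne_zero sw_h0_ne hp hs).linearImage G).energyPerParticle lennardJones)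
    (t : ℤ → ℤ) (P : ℕ) (hP : P ≠ 0) (ht : ∀ i, t (i + P) = t i) (htH : IsHaggSeq t)
    (G' : EuclideanSpace ℝ (Fin 3) ≃L[ℝ] EuclideanSpace ℝ (Fin 3))
    (hG' : ∀ v : EuclideanSpace ℝ (Fin 3), 4 / 5 * ‖v‖ ≤ ‖G' v‖ ∧ ‖G' v‖ ≤ 6 / 5 * ‖v‖)
    {r : ℝ} (hr0 : 0 ≤ r) (hr1 : r ≤ 1 / 10)
    (hfar : ∀ (A : EuclideanSpace ℝ (Fin 3) →ₗᵢ[ℝ] EuclideanSpace ℝ (Fin 3)) (a h : ℝ), 47 / 50 ≤ a → a ≤ 1 → 39 / 50 * a ≤ h → h ≤ 17 / 20 * a →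
      ∃ m u v : ℤ, ‖barlowPos 1 (Real.sqrt 6 / 3) t m u v‖ ≤ 3 ∧
        r ≤ dist (G' (barlowPos 1 (Real.sqrt 6 / 3) t m u v)) (A (barlowPos a h t m u v))) :
    ((⨅ Q : PeriodicConfiguration 3, Q.energyPerParticle lennardJones) + 50 * r₀ ^ 2 * κ * r ^ 2) * (P : ℝ) +
        ∑ k ∈ Finset.range P, (if t ((k : ℤ) - 1) = t k then min (cH / 2) (κ * r₀ ^ 2 / 2) else 0) ≤
      ∑ k ∈ Finset.range P, (1 / 2 : ℝ) * ∑' q : ℤ × ℤ × ℤ,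
        lennardJones (dist (G' (barlowPos 1 (Real.sqrt 6 / 3) t k 0 0)) (G' (barlowPos 1 (Real.sqrt 6 / 3) t q.1 q.2.1 q.2.2))) := by
  have hPpos : (0 : ℝ) < (P : ℝ) := by exact_mod_cast Nat.pos_of_ne_zero hP
  have hid := energyPerParticle_linearImage_barlow_eq_average lennardJones lennardJones_zero one_pos
    cbbc_sqrt_six_div_three_pos one_ne_zero sw_h0_ne hP ht G'
  set X : ℝ := ∑ k ∈ Finset.range P, (1 / 2 : ℝ) * ∑' q : ℤ × ℤ × ℤ,
        lennardJones (dist (G' (barlowPos 1 (Real.sqrt 6 / 3) t k 0 0)) (G' (barlowPos 1 (Real.sqrt 6 / 3) t q.1 q.2.1 q.2.2)))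
    with hX
  set E : ℝ := (⨅ Q : PeriodicConfiguration 3, Q.energyPerParticle lennardJones) with hE
  set μ : ℝ := min (cH / 2) (κ * r₀ ^ 2 / 2) with hμ
  set C : ℝ := ∑ k ∈ Finset.range P, (if t ((k : ℤ) - 1) = t k then (1 : ℝ) else 0) with hC
  obtain ⟨hC0, hCP⟩ := swp_sum_ite_bounds t P
  rw [← hC] at hC0 hCP
  have hμ1 : μ ≤ cH / 2 := min_le_left _ _
  have hμ2 : μ ≤ κ * r₀ ^ 2 / 2 := min_le_right _ _
  have hr₀sq : r₀ ^ 2 ≤ 1 / 100 := by nlinarith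
  have hr₀sq0 : 0 < r₀ ^ 2 := by positivity
  have hκr₀ : 0 < κ * r₀ ^ 2 := mul_pos hκ hr₀sq0
  have hμ0 : 0 ≤ μ := le_min (by linarith) (by linarith)
  rw [swp_sum_ite_const t (Finset.range P) μ, ← hC]
  have hr2 : 0 ≤ r ^ 2 := sq_nonneg r
  by_cases hnear : ∃ (A : EuclideanSpace ℝ (Fin 3) →ₗᵢ[ℝ] EuclideanSpace ℝ (Fin 3)) (a h : ℝ), 47 / 50 ≤ a ∧ a ≤ 1 ∧
      39 / 50 * a ≤ h ∧ h ≤ 17 / 20 * a ∧ ∀ m u v : ℤ, ‖barlowPos 1 (Real.sqrt 6 / 3) t m u v‖ ≤ 3 →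
        dist (G' (barlowPos 1 (Real.sqrt 6 / 3) t m u v)) (A (barlowPos a h t m u v)) < r₀
  · -- near the family: average CBBC(t, r) with CBBC(alt, 0) + CUSHION
    have h1 := hCB t P hP ht htH G' hG' r hr0 hr1 hfar
    have h2 := hCB alternatingHagg 2 two_ne_zero swp_alt_periodic isHaggSeq_alternating G' hG' 0 le_rfl (by norm_num)
      (swp_famFar_zero alternatingHagg G')
    have h3 := hCU t P hP ht htH G' hG' hnear
    rw [hid] at h1 h3
    rw [swp_card_filter_eq_sum t P, ← hC] at h3
    set A : ℝ := ((barlowPeriodicConfiguration alternatingHagg one_ne_zero sw_h0_ne two_ne_zero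
      swp_alt_periodic).linearImage G').energyPerParticle lennardJones with hA
    have h1' := (le_div_iff₀ hPpos).1 h1
    have h3' := (le_div_iff₀ hPpos).1 h3
    have h3'' : A * (P : ℝ) + cH * C ≤ X := by
      have hcalc : (A + cH * C / (P : ℝ)) * (P : ℝ) = A * (P : ℝ) + cH * C := by
        field_simp
      linarith [hcalc]
    have h2' : E ≤ A := by
      have : κ * (0 : ℝ) ^ 2 = 0 := by ring
      linarith
    have hEA : E * (P : ℝ) ≤ A * (P : ℝ) := mul_le_mul_of_nonneg_right h2' hPpos.le
    have hμC : μ * C ≤ cH / 2 * C := mul_le_mul_of_nonneg_right hμ1 hC0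
    have hκP : 50 * r₀ ^ 2 * κ * (r ^ 2 * (P : ℝ)) ≤ κ / 2 * (r ^ 2 * (P : ℝ)) := by
      apply mul_le_mul_of_nonneg_right _ (by positivity)
      nlinarith
    nlinarith [h1', h3'', hEA, hμC, hκP]
  · -- far from the family: CBBC at `r = r₀`
    push Not at hnear
    have h1 := hCB t P hP ht htH G' hG' r₀ hr₀.le hr₀1 hnear
    rw [hid] at h1
    have h1' := (le_div_iff₀ hPpos).1 h1
    have hrr : r ^ 2 ≤ 1 / 100 := by nlinarith
    have hA : 50 * r₀ ^ 2 * κ * r ^ 2 * (P : ℝ) ≤ κ * r₀ ^ 2 / 2 * (P : ℝ) := by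
      apply mul_le_mul_of_nonneg_right _ hPpos.le
      nlinarith
    have hB : μ * C ≤ κ * r₀ ^ 2 / 2 * (P : ℝ) :=
      calc μ * C ≤ μ * (P : ℝ) := mul_le_mul_of_nonneg_left hCP hμ0
        _ ≤ κ * r₀ ^ 2 / 2 * (P : ℝ) := mul_le_mul_of_nonneg_right hμ2 hPpos.le
    have hexp : (E + κ * r₀ ^ 2) * (P : ℝ) = E * (P : ℝ) + κ * r₀ ^ 2 / 2 * (P : ℝ) + κ * r₀ ^ 2 / 2 * (P : ℝ) := by ring
    nlinarith [h1', hA, hB, hexp]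


/-- **The cushioned uniform window bound.**  Let `G` be continuous linear with `‖G v‖ ≥ (4/5)‖v‖`, `G'` an automorphism with
the same values, `E₀ = e⋆ + κ′r²` with `κ′r² ≥ 0`, `c₁ ≥ 0`, and suppose CBBC⁺ in period-sum form for `G'`: every periodic Hägg
word `t` that is `r`-far under `G'` has `E₀·P + Σ_{k<P}[t(k−1) = t k]·c₁ ≤ Σ_{k<P} S_t(k)`.  Then for every `r`-far Hägg word
`s` and every window `[m, n]`,
`(n−m+1)·E₀ + Σ_{k=m}^{n} [s(k−1) = s k]·c₁ − (99360 + 6|e⋆| + c₁) ≤ Σ_{k=m}^{n} S_s(k)`. [folklore] -/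
theorem swp_window_lower_bound (G : EuclideanSpace ℝ (Fin 3) →L[ℝ] EuclideanSpace ℝ (Fin 3)) (hG : ∀ v, 4 / 5 * ‖v‖ ≤ ‖G v‖)
    (G' : EuclideanSpace ℝ (Fin 3) ≃L[ℝ] EuclideanSpace ℝ (Fin 3)) (hGG' : ∀ x, G' x = G x) {κ r c₁ : ℝ} (hκr : 0 ≤ κ * r ^ 2)
    (hc₁ : 0 ≤ c₁)
    (hCB : ∀ (t : ℤ → ℤ) (P : ℕ) (_hP : P ≠ 0) (_ht : ∀ i, t (i + P) = t i), IsHaggSeq t →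
      (∀ (A : EuclideanSpace ℝ (Fin 3) →ₗᵢ[ℝ] EuclideanSpace ℝ (Fin 3)) (a h : ℝ), 47 / 50 ≤ a → a ≤ 1 → 39 / 50 * a ≤ h → h ≤ 17 / 20 * a →
        ∃ k u v : ℤ, ‖barlowPos 1 (Real.sqrt 6 / 3) t k u v‖ ≤ 3 ∧
          r ≤ dist (G' (barlowPos 1 (Real.sqrt 6 / 3) t k u v)) (A (barlowPos a h t k u v))) →
      ((⨅ Q : PeriodicConfiguration 3, Q.energyPerParticle lennardJones) + κ * r ^ 2) * (P : ℝ) +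
          ∑ k ∈ Finset.range P, (if t ((k : ℤ) - 1) = t k then c₁ else 0) ≤
        ∑ k ∈ Finset.range P, (1 / 2 : ℝ) * ∑' q : ℤ × ℤ × ℤ,
          lennardJones (dist (G' (barlowPos 1 (Real.sqrt 6 / 3) t k 0 0)) (G' (barlowPos 1 (Real.sqrt 6 / 3) t q.1 q.2.1 q.2.2))))
    (s : ℤ → ℤ) (hs : IsHaggSeq s)
    (hfar : ∀ (A : EuclideanSpace ℝ (Fin 3) →ₗᵢ[ℝ] EuclideanSpace ℝ (Fin 3)) (a h : ℝ), 47 / 50 ≤ a → a ≤ 1 → 39 / 50 * a ≤ h → h ≤ 17 / 20 * a →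
      ∃ k u v : ℤ, ‖barlowPos 1 (Real.sqrt 6 / 3) s k u v‖ ≤ 3 ∧
        r ≤ dist (G (barlowPos 1 (Real.sqrt 6 / 3) s k u v)) (A (barlowPos a h s k u v)))
    {m n : ℤ} (hmn : m ≤ n) :
    (((n - m + 1 : ℤ)) : ℝ) * ((⨅ Q : PeriodicConfiguration 3, Q.energyPerParticle lennardJones) + κ * r ^ 2) +
        (∑ k ∈ Finset.Icc m n, (if s (k - 1) = s k then c₁ else 0)) -
        (99360 + 6 * |(⨅ Q : PeriodicConfiguration 3, Q.energyPerParticle lennardJones)| + c₁) ≤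
      ∑ k ∈ Finset.Icc m n, (1 / 2 : ℝ) * ∑' q : ℤ × ℤ × ℤ,
        lennardJones (dist (G (barlowPos 1 (Real.sqrt 6 / 3) s k 0 0)) (G (barlowPos 1 (Real.sqrt 6 / 3) s q.1 q.2.1 q.2.2))) := by
  -- the spliced word
  set N : ℕ := (n - m).toNat + 1 with hNdef
  have hN : (N : ℤ) = n - m + 1 := by rw [hNdef]; push_cast; rw [Int.toNat_of_nonneg (by omega)]
  obtain ⟨t, ht, htH, hnear, hwindow⟩ := sw_exists_splice s hs m N
  have hP : N + 6 ≠ 0 := by omega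
  -- far from the family transfers to `t` and to `G'`
  have hfar_t := sw_famFar_of_agree hnear G r hfar
  have hfar_t' : ∀ (A : EuclideanSpace ℝ (Fin 3) →ₗᵢ[ℝ] EuclideanSpace ℝ (Fin 3)) (a h : ℝ), 47 / 50 ≤ a → a ≤ 1 → 39 / 50 * a ≤ h → h ≤ 17 / 20 * a →
      ∃ k u v : ℤ, ‖barlowPos 1 (Real.sqrt 6 / 3) t k u v‖ ≤ 3 ∧
        r ≤ dist (G' (barlowPos 1 (Real.sqrt 6 / 3) t k u v)) (A (barlowPos a h t k u v)) := by
    intro A a h h1 h2 h3 h4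
    obtain ⟨k, u, v, hk, hr⟩ := hfar_t A a h h1 h2 h3 h4
    exact ⟨k, u, v, hk, by rw [hGG']; exact hr⟩
  -- CBBC⁺ for `t`
  have hE' := hCB t (N + 6) hP ht htH hfar_t'
  simp only [hGG'] at hE'
  -- split the period into padding and window layers
  have hsplit : ∑ k ∈ Finset.range (N + 6), (1 / 2 : ℝ) * ∑' q : ℤ × ℤ × ℤ, lennardJones (dist (G (barlowPos 1 (Real.sqrt 6 / 3) t k 0 0)) (G (barlowPos 1 (Real.sqrt 6 / 3) t q.1 q.2.1 q.2.2))) =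
      (∑ k ∈ Finset.range 3, (1 / 2 : ℝ) * ∑' q : ℤ × ℤ × ℤ, lennardJones (dist (G (barlowPos 1 (Real.sqrt 6 / 3) t k 0 0)) (G (barlowPos 1 (Real.sqrt 6 / 3) t q.1 q.2.1 q.2.2)))) + (∑ k ∈ Finset.Ico 3 (N + 3), (1 / 2 : ℝ) * ∑' q : ℤ × ℤ × ℤ, lennardJones (dist (G (barlowPos 1 (Real.sqrt 6 / 3) t k 0 0)) (G (barlowPos 1 (Real.sqrt 6 / 3) t q.1 q.2.1 q.2.2)))) +
        ∑ k ∈ Finset.Ico (N + 3) (N + 6), (1 / 2 : ℝ) * ∑' q : ℤ × ℤ × ℤ, lennardJones (dist (G (barlowPos 1 (Real.sqrt 6 / 3) t k 0 0)) (G (barlowPos 1 (Real.sqrt 6 / 3) t q.1 q.2.1 q.2.2))) := by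
    rw [Finset.sum_range_add_sum_Ico _ (show 3 ≤ N + 3 by omega),
      Finset.sum_range_add_sum_Ico _ (show N + 3 ≤ N + 6 by omega)]
  have hsite : ∀ k : ℤ, (1 / 2 : ℝ) * ∑' q : ℤ × ℤ × ℤ, lennardJones (dist (G (barlowPos 1 (Real.sqrt 6 / 3) t k 0 0)) (G (barlowPos 1 (Real.sqrt 6 / 3) t q.1 q.2.1 q.2.2))) ≤ (24480 : ℝ) / 2 := fun k => (abs_le.1 (sw_abs_site_le G hG t k)).2
  have hpad1 : ∑ k ∈ Finset.range 3, (1 / 2 : ℝ) * ∑' q : ℤ × ℤ × ℤ, lennardJones (dist (G (barlowPos 1 (Real.sqrt 6 / 3) t k 0 0)) (G (barlowPos 1 (Real.sqrt 6 / 3) t q.1 q.2.1 q.2.2))) ≤ 3 * ((24480 : ℝ) / 2) := by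
    calc ∑ k ∈ Finset.range 3, (1 / 2 : ℝ) * ∑' q : ℤ × ℤ × ℤ, lennardJones (dist (G (barlowPos 1 (Real.sqrt 6 / 3) t k 0 0)) (G (barlowPos 1 (Real.sqrt 6 / 3) t q.1 q.2.1 q.2.2))) ≤ ∑ _k ∈ Finset.range 3, (24480 : ℝ) / 2 :=
          Finset.sum_le_sum fun k _ => hsite k
      _ = 3 * ((24480 : ℝ) / 2) := by rw [Finset.sum_const, Finset.card_range, nsmul_eq_mul]; norm_num
  have hpad2 : ∑ k ∈ Finset.Ico (N + 3) (N + 6), (1 / 2 : ℝ) * ∑' q : ℤ × ℤ × ℤ, lennardJones (dist (G (barlowPos 1 (Real.sqrt 6 / 3) t k 0 0)) (G (barlowPos 1 (Real.sqrt 6 / 3) t q.1 q.2.1 q.2.2))) ≤ 3 * ((24480 : ℝ) / 2) := by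
    calc ∑ k ∈ Finset.Ico (N + 3) (N + 6), (1 / 2 : ℝ) * ∑' q : ℤ × ℤ × ℤ, lennardJones (dist (G (barlowPos 1 (Real.sqrt 6 / 3) t k 0 0)) (G (barlowPos 1 (Real.sqrt 6 / 3) t q.1 q.2.1 q.2.2))) ≤ ∑ _k ∈ Finset.Ico (N + 3) (N + 6), (24480 : ℝ) / 2 :=
          Finset.sum_le_sum fun k _ => hsite k
      _ = 3 * ((24480 : ℝ) / 2) := by
          rw [Finset.sum_const, Nat.card_Ico, show N + 6 - (N + 3) = 3 by omega, nsmul_eq_mul]; norm_num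
  -- the window layers: compare with `s`
  have hcmp : ∀ k ∈ Finset.Ico 3 (N + 3), (1 / 2 : ℝ) * ∑' q : ℤ × ℤ × ℤ, lennardJones (dist (G (barlowPos 1 (Real.sqrt 6 / 3) t k 0 0)) (G (barlowPos 1 (Real.sqrt 6 / 3) t q.1 q.2.1 q.2.2))) ≤ (1 / 2 : ℝ) * ∑' q : ℤ × ℤ × ℤ, lennardJones (dist (G (barlowPos 1 (Real.sqrt 6 / 3) s ((k : ℤ) + (m - 3)) 0 0)) (G (barlowPos 1 (Real.sqrt 6 / 3) s q.1 q.2.1 q.2.2))) +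
      (3240 : ℝ) * (2 * (((((k : ℤ) - 3 + 1 : ℤ)) : ℝ) ^ 2)⁻¹ + 2 * (((((N : ℤ) + 3 - k : ℤ)) : ℝ) ^ 2)⁻¹) := by
    intro k hk
    rw [Finset.mem_Ico] at hk
    have h := sw_cmp_tsum_le G hG (t := t) (t' := s) (A := 3) (B := (N : ℤ) + 3) (c := m - 3) (k := (k : ℤ))
      (fun x hx1 hx2 => hwindow x hx1 hx2) (by exact_mod_cast hk.1) (by exact_mod_cast hk.2)
    have h' := (abs_le.1 h).2
    linarith
  have hwin : ∑ k ∈ Finset.Ico 3 (N + 3), (1 / 2 : ℝ) * ∑' q : ℤ × ℤ × ℤ, lennardJones (dist (G (barlowPos 1 (Real.sqrt 6 / 3) t k 0 0)) (G (barlowPos 1 (Real.sqrt 6 / 3) t q.1 q.2.1 q.2.2))) ≤ (∑ k ∈ Finset.Icc m n, (1 / 2 : ℝ) * ∑' q : ℤ × ℤ × ℤ, lennardJones (dist (G (barlowPos 1 (Real.sqrt 6 / 3) s k 0 0)) (G (barlowPos 1 (Real.sqrt 6 / 3) s q.1 q.2.1 q.2.2)))) + 8 * (3240 : ℝ) :=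 by
    have h1 := Finset.sum_le_sum hcmp
    rw [Finset.sum_add_distrib, sw_sum_window_reindex (fun k => (1 / 2 : ℝ) * ∑' q : ℤ × ℤ × ℤ, lennardJones (dist (G (barlowPos 1 (Real.sqrt 6 / 3) s k 0 0)) (G (barlowPos 1 (Real.sqrt 6 / 3) s q.1 q.2.1 q.2.2)))) hN] at h1
    have h3 : ∑ k ∈ Finset.Ico 3 (N + 3), (3240 : ℝ) * (2 * (((((k : ℤ) - 3 + 1 : ℤ)) : ℝ) ^ 2)⁻¹ +
        2 * (((((N : ℤ) + 3 - k : ℤ)) : ℝ) ^ 2)⁻¹) ≤ (3240 : ℝ) * 8 := by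
      rw [← Finset.mul_sum]
      exact mul_le_mul_of_nonneg_left (sw_sum_window_majorant_le N) (show (0 : ℝ) ≤ 3240 by norm_num)
    linarith
  -- the c-layers of `t` inside the window are those of `s` on `[m+1, n]`
  have hind_k : ∀ k ∈ Finset.Ico 3 (N + 3),
      (if s ((k : ℤ) + (m - 3) - 1) = s ((k : ℤ) + (m - 3)) then c₁ else 0) - (if k = 3 then c₁ else 0) ≤
        (if t ((k : ℤ) - 1) = t k then c₁ else 0) := by
    intro k hk
    rw [Finset.mem_Ico] at hk
    by_cases hk3 : k = 3
    · subst hk3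
      rw [if_pos (rfl : (3 : ℕ) = 3)]
      split_ifs <;> linarith
    · have hw1 := hwindow ((k : ℤ) - 1) (by omega) (by omega)
      have hw2 := hwindow (k : ℤ) (by omega) (by omega)
      rw [if_neg hk3, hw1, hw2, show (k : ℤ) - 1 + (m - 3) = (k : ℤ) + (m - 3) - 1 by ring]
      linarith
  have hind : (∑ k ∈ Finset.Icc m n, (if s (k - 1) = s k then c₁ else 0)) - c₁ ≤
      ∑ k ∈ Finset.range (N + 6), (if t ((k : ℤ) - 1) = t k then c₁ else 0) := by
    have h1 := Finset.sum_le_sum hind_k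
    rw [Finset.sum_sub_distrib, sw_sum_window_reindex (fun k => (if s (k - 1) = s k then c₁ else 0)) hN,
      Finset.sum_ite_eq' (Finset.Ico 3 (N + 3)) 3 (fun _ => c₁), if_pos (by rw [Finset.mem_Ico]; omega)] at h1
    have h2 : ∑ k ∈ Finset.Ico 3 (N + 3), (if t ((k : ℤ) - 1) = t k then c₁ else 0) ≤
        ∑ k ∈ Finset.range (N + 6), (if t ((k : ℤ) - 1) = t k then c₁ else 0) := by
      apply Finset.sum_le_sum_of_subset_of_nonneg
      · intro k hk
        rw [Finset.mem_Ico] at hk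
        rw [Finset.mem_range]
        omega
      · intro k _ _
        split_ifs <;> linarith
    linarith
  -- assemble
  have hPpos : (0 : ℝ) < ((N + 6 : ℕ) : ℝ) := by positivity
  have hcast : ((N + 6 : ℕ) : ℝ) = (((n - m + 1 : ℤ)) : ℝ) + 6 := by
    have : (((N + 6 : ℕ) : ℤ)) = (n - m + 1) + 6 := by push_cast; omega
    exact_mod_cast this
  have hexp : ((⨅ Q : PeriodicConfiguration 3, Q.energyPerParticle lennardJones) + κ * r ^ 2) * ((N + 6 : ℕ) : ℝ) =
      (((n - m + 1 : ℤ)) : ℝ) * ((⨅ Q : PeriodicConfiguration 3, Q.energyPerParticle lennardJones) + κ * r ^ 2) + 6 * (⨅ Q : PeriodicConfiguration 3, Q.energyPerParticle lennardJones) + 6 * (κ * r ^ 2) := by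
    rw [hcast]; ring
  have habs : -(⨅ Q : PeriodicConfiguration 3, Q.energyPerParticle lennardJones) ≤ |(⨅ Q : PeriodicConfiguration 3, Q.energyPerParticle lennardJones)| := neg_le_abs _
  linarith

/-- **The reduction `sitewisePlus_of_cbbc_cushion` (CBBC + CUSHION ⟹ SITEWISE⁺), proved.**  Hypotheses: CBBC — the registered
conclusion of `stub_cauchyBornBarlowCoercivity` (for periodic Hägg words `s`, automorphisms `G` in the `4/5–6/5` tube and
`r ∈ [0,1/10]` with `G` `r`-far from the box family on the unit sites of norm `≤ 3`, `e⋆ + κ r² ≤ e(G·T_s)`); CUSHION — the strained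
Hägg cushion at nearness radius `r₀ ∈ (0, 1/10]` (if `G` is within `r₀` of some box-scaled isometric template on the unit sites of
norm `≤ 3`, then `e(G·T_alt) + cH·#{m < p : s(m−1) = s m}/p ≤ e(G·T_s)`, `alt` the alternating word).  Conclusion: the registered text of
`stub_sitewisePlus` — for every periodic Hägg `s`, continuous linear `G` in the tube and `r ∈ [0, 1/10]` with `G` `r`-far, a corrector
`|w| ≤ Cw` with `e⋆ + κ⁺r² + [s(m−1) = s m]·cH⁺ ≤ S_s(m) + w(m−1) − w m` at every layer, `κ⁺ = 50r₀²κ`, `cH⁺ = min(cH/2, κr₀²/2)`,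
`Cw = 99360 + 6|e⋆| + cH⁺`.  Proof: `swp_cbbcPlusR` feeds `swp_window_lower_bound`, whose uniform window deficit is turned into the
corrector by `exists_corrector_of_window_sum_ge` (left Mañé potential). [folklore] -/
theorem sitewisePlus_of_cbbc_cushion {r₀ : ℝ} (hr₀ : 0 < r₀) (hr₀1 : r₀ ≤ 1 / 10) :
    (∃ κ : ℝ, 0 < κ ∧ ∀ (s : ℤ → ℤ) (p : ℕ) (hp : p ≠ 0) (hs : ∀ i, s (i + p) = s i), IsHaggSeq s →
      ∀ (G : EuclideanSpace ℝ (Fin 3) ≃L[ℝ] EuclideanSpace ℝ (Fin 3)),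
        (∀ v : EuclideanSpace ℝ (Fin 3), 4 / 5 * ‖v‖ ≤ ‖G v‖ ∧ ‖G v‖ ≤ 6 / 5 * ‖v‖) →
        ∀ r : ℝ, 0 ≤ r → r ≤ 1 / 10 →
          (∀ (A : EuclideanSpace ℝ (Fin 3) →ₗᵢ[ℝ] EuclideanSpace ℝ (Fin 3)) (a h : ℝ), 47 / 50 ≤ a → a ≤ 1 → 39 / 50 * a ≤ h → h ≤ 17 / 20 * a →
            ∃ m u v : ℤ, ‖barlowPos 1 (Real.sqrt 6 / 3) s m u v‖ ≤ 3 ∧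
              r ≤ dist (G (barlowPos 1 (Real.sqrt 6 / 3) s m u v)) (A (barlowPos a h s m u v))) →
          (⨅ Q : PeriodicConfiguration 3, Q.energyPerParticle lennardJones) + κ * r ^ 2 ≤
            ((barlowPeriodicConfiguration s one_ne_zero
                (div_ne_zero (Real.sqrt_ne_zero'.2 (by norm_num)) three_ne_zero : Real.sqrt 6 / 3 ≠ 0) hp hs).linearImage
              G).energyPerParticle lennardJones) →
    (∃ cH : ℝ, 0 < cH ∧ ∀ (s : ℤ → ℤ) (p : ℕ) (hp : p ≠ 0) (hs : ∀ i, s (i + p) = s i), IsHaggSeq s →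
      ∀ (G : EuclideanSpace ℝ (Fin 3) ≃L[ℝ] EuclideanSpace ℝ (Fin 3)),
        (∀ v : EuclideanSpace ℝ (Fin 3), 4 / 5 * ‖v‖ ≤ ‖G v‖ ∧ ‖G v‖ ≤ 6 / 5 * ‖v‖) →
        (∃ (A : EuclideanSpace ℝ (Fin 3) →ₗᵢ[ℝ] EuclideanSpace ℝ (Fin 3)) (a h : ℝ), 47 / 50 ≤ a ∧ a ≤ 1 ∧ 39 / 50 * a ≤ h ∧
            h ≤ 17 / 20 * a ∧ ∀ m u v : ℤ, ‖barlowPos 1 (Real.sqrt 6 / 3) s m u v‖ ≤ 3 →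
              dist (G (barlowPos 1 (Real.sqrt 6 / 3) s m u v)) (A (barlowPos a h s m u v)) < r₀) →
        ((barlowPeriodicConfiguration alternatingHagg one_ne_zero
                (div_ne_zero (Real.sqrt_ne_zero'.2 (by norm_num)) three_ne_zero : Real.sqrt 6 / 3 ≠ 0) two_ne_zero
                (fun i => by exact_mod_cast alternatingHagg_periodic i)).linearImage G).energyPerParticle lennardJones +
            cH * (((Finset.range p).filter (fun m : ℕ => s ((m : ℤ) - 1) = s m)).card : ℝ) / p ≤
          ((barlowPeriodicConfiguration s one_ne_zero
                (div_ne_zero (Real.sqrt_ne_zero'.2 (by norm_num)) three_ne_zero : Real.sqrt 6 / 3 ≠ 0) hp hs).linearImage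
              G).energyPerParticle lennardJones) →
    ∃ κ : ℝ, 0 < κ ∧ ∃ Cw cH : ℝ, 0 < cH ∧ ∀ (s : ℤ → ℤ) (p : ℕ), p ≠ 0 → (∀ i, s (i + p) = s i) → IsHaggSeq s →
      ∀ (G : (EuclideanSpace ℝ (Fin 3) →L[ℝ] EuclideanSpace ℝ (Fin 3))),
        (∀ v : EuclideanSpace ℝ (Fin 3), 4 / 5 * ‖v‖ ≤ ‖G v‖ ∧ ‖G v‖ ≤ 6 / 5 * ‖v‖) →
        ∀ r : ℝ, 0 ≤ r → r ≤ 1 / 10 →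
          (∀ (A : EuclideanSpace ℝ (Fin 3) →ₗᵢ[ℝ] EuclideanSpace ℝ (Fin 3)) (a h : ℝ), 47 / 50 ≤ a → a ≤ 1 → 39 / 50 * a ≤ h → h ≤ 17 / 20 * a →
            ∃ m u v : ℤ, ‖barlowPos 1 (Real.sqrt 6 / 3) s m u v‖ ≤ 3 ∧
              r ≤ dist (G (barlowPos 1 (Real.sqrt 6 / 3) s m u v)) (A (barlowPos a h s m u v))) →
          ∃ w : ℤ → ℝ, (∀ n : ℤ, |w n| ≤ Cw) ∧ ∀ m : ℤ,
            (⨅ Q : PeriodicConfiguration 3, Q.energyPerParticle lennardJones) + κ * r ^ 2 +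
                (if s (m - 1) = s m then cH else 0) ≤
              (1 / 2 : ℝ) * (∑' q : {q : ℤ × ℤ × ℤ // q ≠ (m, 0, 0)},
                lennardJones ‖G (barlowPos 1 (Real.sqrt 6 / 3) s q.1.1 q.1.2.1 q.1.2.2 -
                  barlowPos 1 (Real.sqrt 6 / 3) s m 0 0)‖) + w (m - 1) - w m := by
  rintro ⟨κ, hκ, hCB⟩ ⟨cH, hcH, hCU⟩
  set μ : ℝ := min (cH / 2) (κ * r₀ ^ 2 / 2) with hμdef
  have hμpos : 0 < μ := lt_min (by linarith) (by positivity)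
  refine ⟨50 * r₀ ^ 2 * κ, by positivity, (99360 + 6 * |(⨅ Q : PeriodicConfiguration 3, Q.energyPerParticle lennardJones)| + μ), μ,
    hμpos, ?_⟩
  intro s p _hp _hs hH G hG r hr0 hr1 hfar
  -- the automorphism with the same values
  obtain ⟨G', hGG'⟩ := sw_exists_cle G (fun v => (hG v).1)
  have hGlow : ∀ v : EuclideanSpace ℝ (Fin 3), 4 / 5 * ‖v‖ ≤ ‖G v‖ := fun v => (hG v).1
  have hG'tube : ∀ v : EuclideanSpace ℝ (Fin 3), 4 / 5 * ‖v‖ ≤ ‖G' v‖ ∧ ‖G' v‖ ≤ 6 / 5 * ‖v‖ := fun v => by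
    rw [hGG']; exact hG v
  have hκr : 0 ≤ 50 * r₀ ^ 2 * κ * r ^ 2 := by positivity
  -- CBBC⁺ in period-sum form for `G'` at the fixed `r`
  have hCBp := fun (t : ℤ → ℤ) (P : ℕ) (hP : P ≠ 0) (ht : ∀ i, t (i + P) = t i) (htH : IsHaggSeq t)
      (hfar_t : ∀ (A : EuclideanSpace ℝ (Fin 3) →ₗᵢ[ℝ] EuclideanSpace ℝ (Fin 3)) (a h : ℝ), 47 / 50 ≤ a → a ≤ 1 → 39 / 50 * a ≤ h → h ≤ 17 / 20 * a →
        ∃ k u v : ℤ, ‖barlowPos 1 (Real.sqrt 6 / 3) t k u v‖ ≤ 3 ∧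
          r ≤ dist (G' (barlowPos 1 (Real.sqrt 6 / 3) t k u v)) (A (barlowPos a h t k u v))) =>
    swp_cbbcPlusR hκ hcH hr₀ hr₀1 hCB hCU t P hP ht htH G' hG'tube hr0 hr1 hfar_t
  -- the uniform window bound for `f k = S_G(k) - e⋆ - κ⁺ r² - [c-layer]·μ`
  have hwin : ∀ m n : ℤ, m ≤ n →
      -(99360 + 6 * |(⨅ Q : PeriodicConfiguration 3, Q.energyPerParticle lennardJones)| + μ) ≤
        ∑ k ∈ Finset.Icc m n, (((1 / 2 : ℝ) * ∑' q : ℤ × ℤ × ℤ, lennardJones (dist (G (barlowPos 1 (Real.sqrt 6 / 3) s k 0 0)) (G (barlowPos 1 (Real.sqrt 6 / 3) s q.1 q.2.1 q.2.2)))) - (⨅ Q : PeriodicConfiguration 3, Q.energyPerParticle lennardJones) - 50 * r₀ ^ 2 * κ * r ^ 2 -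
          (if s (k - 1) = s k then μ else 0)) := by
    intro m n hmn
    have h := swp_window_lower_bound G hGlow G' hGG' hκr hμpos.le hCBp s hH hfar hmn
    rw [Finset.sum_sub_distrib, Finset.sum_sub_distrib, Finset.sum_sub_distrib, Finset.sum_const, Finset.sum_const,
      Int.card_Icc, nsmul_eq_mul, nsmul_eq_mul]
    have hc : (((n + 1 - m).toNat : ℕ) : ℝ) = (((n - m + 1 : ℤ)) : ℝ) := by
      have h0 : (((n + 1 - m).toNat : ℕ) : ℤ) = n - m + 1 := by rw [Int.toNat_of_nonneg (by omega)]; ring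
      exact_mod_cast h0
    rw [hc]
    have hexp : (((n - m + 1 : ℤ)) : ℝ) * ((⨅ Q : PeriodicConfiguration 3, Q.energyPerParticle lennardJones) + 50 * r₀ ^ 2 * κ * r ^ 2) =
        (((n - m + 1 : ℤ)) : ℝ) * (⨅ Q : PeriodicConfiguration 3, Q.energyPerParticle lennardJones) +
          (((n - m + 1 : ℤ)) : ℝ) * (50 * r₀ ^ 2 * κ * r ^ 2) := by ring
    linarith
  -- the corrector
  obtain ⟨u, g, hu, hg, hfug⟩ := Literature.Dynamics.Ergodic.exists_corrector_of_window_sum_ge hwin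
  refine ⟨u, fun k => ?_, fun k => ?_⟩
  · rw [abs_le]
    refine ⟨(hu k).1, ?_⟩
    have h1 := (hu k).2
    have h2 := (abs_le.1 (sw_abs_site_le G hGlow s k)).2
    have h3 : -(⨅ Q : PeriodicConfiguration 3, Q.energyPerParticle lennardJones) ≤ |(⨅ Q : PeriodicConfiguration 3, Q.energyPerParticle lennardJones)| := neg_le_abs _
    have h4 : (0 : ℝ) ≤ (if s (k - 1) = s k then μ else 0) := by split_ifs <;> linarith
    have h5 : 0 ≤ 50 * r₀ ^ 2 * κ * r ^ 2 := hκr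
    have h6 := abs_nonneg (⨅ Q : PeriodicConfiguration 3, Q.energyPerParticle lennardJones)
    linarith
  · have h := hfug k
    have hgk := hg k
    rw [← sw_site_eq_conclusion G s k]
    linarith

end Summit.AtomisticToContinuum.Crystallization.Theorems.NashClassCertificatesNashNearField

end
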